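import Summits.QuantumFields.BalabanUV.T4Continuum.Support.AveragingDeficitCounting

/-!
# AveragingDeficitLatticeH2Prep (T⁴ programme, node NE3, row NE3-R2, gen 4) — lattice calculus for the DISCRETE
# CACCIOPPOLI INEQUALITY FOR SECOND DIFFERENCES on `ℤ^d`: forward/second differences and the flat Laplacian, `ℓ^∞`
# boxes and the shift invariance of box sums of functions supported one layer inside, the piecewise-linear cutoff,
# and the two SUMMATIONS BY PARTS against `χ²` that produce the interior-`H²` identity

HONEST FRAMING (cell `pub-balaban`, T4-DAG PAGE 1; unit `b2b-balaban-t4-ne3r2-p1` = owner of BINDER-OWNERS row NE3-R2,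
gen 4).  The cell's T4 target is the finite-torus continuum limit of the unit-scale averaged loop expectations — NOT
infinite volume, NO mass gap, NOT Clay, NOT summit progress.  This file and its sequel `AveragingDeficitLatticeH2` are
PURE LATTICE ANALYSIS with values in a real inner-product space `E`; nothing in them mentions a gauge field.  Their
use (file `AveragingDeficitKDatum`): B11 Theorem 1 prints, PER CUBE `□` and in a local gauge, sup bounds on the vector
potential `A`, its first differences `∇^ηA` ((8)) and on `∂^{η*}∂^ηA`, `Δ^ηA` ((10)); the energy route of NE3 and row
NE3's action sandwich consume instead the `ℓ²` norm of the covariant gradient of the flux, `‖∇_U F‖_{ℓ²(□)}`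
(`T4AveragingDeficitWall.gradFluxSq`; the slot `MinimalActionRate.Regular.grad` and the `√gradFluxSq` factor of
`AveragingDeficitDualResidual.dualResidual_torus`), whose leading term is made of ALL mixed second differences
`∇_κ∇_μ A_ν` — controlled by the Laplacian in `ℓ²` (and not in sup norm), cube by cube, exactly by the discrete
Caccioppoli inequality proved in the sequel.  The abstract operator core of that inequality is already in the tree
(`T4ConvexResponse.sum_inner_comp_cutoff_eq`, §4d «stated, not kernelised» for the lattice); these two files are the
lattice instance, proved directly.

CONTENT (all [folklore], 0 sorry): §1 `fd` (forward difference), `sd` (second difference), `lap` (flat componentwise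
lattice Laplacian `Σ_i sd_i`), `sd_eq`, `fd_comm`, `lap_fd` (the Laplacian commutes with differences); §2 `mem_box`
(`box_mono`, `self_mem_box` are `AveragingDeficitCounting`'s), unit steps (`add_e_mem_box_succ`, `sub_e_mem_box_succ`,
`add_e_not_mem`, `sub_e_not_mem`) and
**`sum_box_shift`**: `Σ_{x ∈ box R y} g(x − e_i) = Σ_{x ∈ box R y} g(x)` for `g` vanishing off `box K y`, `K + 1 ≤ R`
(the «no boundary term» of every summation by parts below); §3 the cutoff `chi R M y = max(0, 1 − exc/M)` with
`exc` the `ℓ^∞` excess over `box R y`: values in `[0,1]`, `= 1` on `box R y`, `= 0` off `box (R+M) y`, `1/M`-Lipschitz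
under unit steps (`abs_chi_sub_le`, `abs_chi_add_sub_le`); §4 **`sbp`** (summation by parts against a supported weight),
`sum_sq_fd_eq` (`Σ χ²‖D_i g‖² = −Σ χ²⟪g, sd_i g⟫ − Σ (χ²(x) − χ²(x−e_i))⟪g(x), D_i g(x−e_i)⟫`) and `neg_sum_fd_lap_eq`
(`−Σ χ²⟪D_j f, D_jΔf⟫ = Σ χ²⟪Δf, sd_j f⟫ + Σ (χ²(x) − χ²(x−e_j))⟪Δf(x), D_j f(x−e_j)⟫`).
DESIGN: the cutoff's `exc` uses truncated `ℕ` subtraction and `Finset.sup` over `Fin d` deliberately (for `d = 0` every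
box is the one-point lattice and `exc = 0`); `M = 0` is excluded where it matters (`1 ≤ M`).  Context for the use:
T. Bałaban, Commun. Math. Phys. **102** (1985) 277–309 [Balaban1985Variational], Thm 1 (8)–(10) p. 279; for the
continuum Caccioppoli inequality: M. Giaquinta, *Multiple integrals in the calculus of variations and nonlinear elliptic
systems* (1983) Ch. III; no printed sentence is a hypothesis here.  PLACEMENT: `Summits/QuantumFields/BalabanUV/` (human
rule 2026-08-19).  Record: HOME `t4/T4-EST-NE3-R2.md` v0.5.
-/

set_option autoImplicit false

open scoped BigOperators

namespace Summit.QuantumFields.BalabanUV.T4Continuum.AveragingDeficitLatticeH2Prep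

open Literature.MathematicalPhysics.QuantumFieldTheory.Balaban1983to89
open B7Prop1Explicit (e e_apply)
open AveragingDeficitCounting (box_mono self_mem_box)

noncomputable section

variable {d : ℕ} {E : Type*} [NormedAddCommGroup E]

local notation "Site" => B7Prop1Explicit.Site
local notation "box" => T4AveragingDeficitWall.box

/-! ## §1 Differences and the lattice Laplacian -/

/-- The forward difference `(D_i f)(x) = f(x + e_i) − f(x)`. [folklore] -/
def fd (i : Fin d) (f : Site d → E) : Site d → E := fun x => f (x + e i) - f x

/-- The second difference `f(x + e_i) − 2f(x) + f(x − e_i)` along `i`. [folklore] -/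
def sd (i : Fin d) (f : Site d → E) : Site d → E := fun x => (f (x + e i) - f x) - (f x - f (x - e i))

/-- The (flat, componentwise) lattice Laplacian `Δf(x) = Σ_i [f(x + e_i) − 2f(x) + f(x − e_i)]`. [folklore] -/
def lap (f : Site d → E) : Site d → E := fun x => ∑ i, sd i f x

/-- `sd_i f(x) = D_i f(x) − D_i f(x − e_i)`. [folklore] -/
theorem sd_eq (i : Fin d) (f : Site d → E) (x : Site d) : sd i f x = fd i f x - fd i f (x - e i) := by
  simp only [sd, fd, sub_add_cancel]

/-- `D_i f (x − e_i) = f x − f (x − e_i)`. [folklore] -/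
theorem fd_sub_e (i : Fin d) (f : Site d → E) (x : Site d) : fd i f (x - e i) = f x - f (x - e i) := by
  simp only [fd, sub_add_cancel]

/-- Forward differences commute. [folklore] -/
theorem fd_comm (i j : Fin d) (f : Site d → E) (x : Site d) : fd i (fd j f) x = fd j (fd i f) x := by
  simp only [fd, add_right_comm x (e i) (e j)]
  abel

/-- The Laplacian commutes with forward differences. [folklore] -/
theorem lap_fd (j : Fin d) (f : Site d → E) (x : Site d) : lap (fd j f) x = fd j (lap f) x := by
  simp only [lap, fd, sd, Finset.sum_sub_distrib]
  have h1 : ∀ i : Fin d, x + e j + e i = x + e i + e j := fun i => add_right_comm x (e j) (e i)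
  have h2 : ∀ i : Fin d, x + e j - e i = x - e i + e j := fun i => by abel
  simp only [h1, h2]
  abel

/-! ## §2 Boxes: membership, monotonicity, unit steps, the shift-invariance of box sums of supported functions -/

/-- Membership in the `ℓ^∞` box. [folklore] -/
theorem mem_box {R : ℕ} {y x : Site d} : x ∈ box R y ↔ ∀ i, y i - R ≤ x i ∧ x i ≤ y i + R := by
  unfold T4AveragingDeficitWall.box
  rw [Finset.mem_Icc]
  constructor
  · rintro ⟨h1, h2⟩ i
    exact ⟨by simpa using h1 i, by simpa using h2 i⟩
  · intro h
    exact ⟨fun i => by simpa using (h i).1, fun i => by simpa using (h i).2⟩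

/-- A unit step from a point of `box K y` stays in `box (K+1) y`. [folklore] -/
theorem mem_box_succ_of_step {K : ℕ} {y x x' : Site d} (hx : x ∈ box K y) (h : ∀ j, |x' j - x j| ≤ 1) :
    x' ∈ box (K + 1) y := by
  rw [mem_box] at hx ⊢
  intro j
  have h1 := hx j
  have h2 := h j
  rw [abs_le] at h2
  push_cast
  constructor <;> linarith [h2.1, h2.2]

/-- `|(e_i)_j| ≤ 1`. [folklore] -/
theorem abs_e_apply_le (i j : Fin d) : |(e i : Site d) j| ≤ 1 := by
  rw [e_apply]; split_ifs <;> simp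

/-- `x + e_i ∈ box (K+1) y` for `x ∈ box K y`. [folklore] -/
theorem add_e_mem_box_succ {K : ℕ} {y x : Site d} (hx : x ∈ box K y) (i : Fin d) : x + e i ∈ box (K + 1) y :=
  mem_box_succ_of_step hx fun j => by simpa using abs_e_apply_le i j

/-- `x − e_i ∈ box (K+1) y` for `x ∈ box K y`. [folklore] -/
theorem sub_e_mem_box_succ {K : ℕ} {y x : Site d} (hx : x ∈ box K y) (i : Fin d) : x - e i ∈ box (K + 1) y :=
  mem_box_succ_of_step hx fun j => by
    have := abs_e_apply_le (d := d) i j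
    simp only [Pi.sub_apply, sub_sub_cancel_left, abs_neg]
    exact this

/-- If `x ∉ box (K+1) y` then `x + e_i ∉ box K y`. [folklore] -/
theorem add_e_not_mem {K : ℕ} {y x : Site d} (hx : x ∉ box (K + 1) y) (i : Fin d) : x + e i ∉ box K y := by
  intro h
  have := sub_e_mem_box_succ h i
  simp only [add_sub_cancel_right] at this
  exact hx this

/-- If `x ∉ box (K+1) y` then `x − e_i ∉ box K y`. [folklore] -/
theorem sub_e_not_mem {K : ℕ} {y x : Site d} (hx : x ∉ box (K + 1) y) (i : Fin d) : x - e i ∉ box K y := by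
  intro h
  have := add_e_mem_box_succ h i
  simp only [sub_add_cancel] at this
  exact hx this

/-- SHIFT INVARIANCE of a box sum of a function supported one layer inside: for `g` vanishing off `box K y` and
`K + 1 ≤ R`, `Σ_{x ∈ box R y} g(x − e_i) = Σ_{x ∈ box R y} g(x)`. [folklore] -/
theorem sum_box_shift {R K : ℕ} (hKR : K + 1 ≤ R) (y : Site d) (i : Fin d) (g : Site d → ℝ)
    (hg : ∀ x, x ∉ box K y → g x = 0) :
    ∑ x ∈ box R y, g (x - e i) = ∑ x ∈ box R y, g x := by
  classical
  have hsub : box K y ⊆ box R y := box_mono (by omega) y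
  have himg : (box K y).image (· + e i) ⊆ box R y := by
    intro x hx
    obtain ⟨z, hz, rfl⟩ := Finset.mem_image.mp hx
    exact box_mono hKR y (add_e_mem_box_succ hz i)
  have hinj : Set.InjOn (· + e i) (box K y : Set (Site d)) := fun a _ b _ h => add_right_cancel h
  calc ∑ x ∈ box R y, g (x - e i) = ∑ x ∈ (box K y).image (· + e i), g (x - e i) := by
        symm
        refine Finset.sum_subset himg fun x _ hx => hg _ fun hmem => hx ?_
        exact Finset.mem_image.mpr ⟨x - e i, hmem, sub_add_cancel x (e i)⟩
    _ = ∑ z ∈ box K y, g (z + e i - e i) := Finset.sum_image hinj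
    _ = ∑ z ∈ box K y, g z := by simp only [add_sub_cancel_right]
    _ = ∑ x ∈ box R y, g x := Finset.sum_subset hsub fun x _ hx => hg x hx

/-! ## §3 The cutoff -/

/-- The `ℓ^∞` excess of `x` over the box `box R y` (a natural number; `0` exactly on the box). [folklore] -/
def exc (R : ℕ) (y x : Site d) : ℕ := Finset.univ.sup fun i : Fin d => (x i - y i).natAbs - R

/-- The piecewise-linear cutoff `χ(x) = max(0, 1 − exc(x)/M)`: `1` on `box R y`, `0` off `box (R+M) y`,
`1/M`-Lipschitz under unit steps, values in `[0,1]`. [folklore] -/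
def chi (R M : ℕ) (y x : Site d) : ℝ := max 0 (1 - (exc R y x : ℝ) / M)

/-- `0 ≤ χ`. [folklore] -/
theorem chi_nonneg (R M : ℕ) (y x : Site d) : 0 ≤ chi R M y x := le_max_left _ _

/-- `χ ≤ 1`. [folklore] -/
theorem chi_le_one (R M : ℕ) (y x : Site d) : chi R M y x ≤ 1 := by
  unfold chi
  refine max_le zero_le_one ?_
  have : (0 : ℝ) ≤ (exc R y x : ℝ) / M := by positivity
  linarith

/-- `exc = 0` on the box. [folklore] -/
theorem exc_eq_zero_of_mem {R : ℕ} {y x : Site d} (hx : x ∈ box R y) : exc R y x = 0 := by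
  rw [mem_box] at hx
  apply Nat.eq_zero_of_le_zero
  refine Finset.sup_le fun i _ => ?_
  have h := hx i
  have : (x i - y i).natAbs ≤ R := by
    rw [← Int.ofNat_le, Int.natCast_natAbs]
    exact abs_le.mpr ⟨by linarith [h.1], by linarith [h.2]⟩
  simp [this]

/-- Off `box (R+M) y` the excess exceeds `M`. [folklore] -/
theorem succ_le_exc_of_not_mem {R M : ℕ} {y x : Site d} (hx : x ∉ box (R + M) y) : M + 1 ≤ exc R y x := by
  rw [mem_box] at hx
  push Not at hx
  obtain ⟨i, hi⟩ := hx
  have hR : R + M + 1 ≤ (x i - y i).natAbs := by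
    by_contra hlt
    push Not at hlt
    have h' : |x i - y i| ≤ (R + M : ℕ) := by
      rw [← Int.natCast_natAbs]; exact_mod_cast (by omega : (x i - y i).natAbs ≤ R + M)
    rw [abs_le] at h'
    exact absurd (hi (by push_cast at h' ⊢; linarith [h'.1])) (by push_cast at h' ⊢; linarith [h'.2])
  calc M + 1 ≤ (x i - y i).natAbs - R := by omega
    _ ≤ exc R y x := Finset.le_sup (f := fun i : Fin d => (x i - y i).natAbs - R) (Finset.mem_univ i)

/-- `χ = 1` on `box R y`. [folklore] -/
theorem chi_eq_one_of_mem {R M : ℕ} {y x : Site d} (hx : x ∈ box R y) : chi R M y x = 1 := by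
  unfold chi; rw [exc_eq_zero_of_mem hx]; simp

/-- `χ = 0` off `box (R+M) y` (for `M ≥ 1`). [folklore] -/
theorem chi_eq_zero_of_not_mem {R M : ℕ} (hM : 1 ≤ M) {y x : Site d} (hx : x ∉ box (R + M) y) :
    chi R M y x = 0 := by
  unfold chi
  refine max_eq_left ?_
  have h := succ_le_exc_of_not_mem hx
  have hM' : (0 : ℝ) < M := by exact_mod_cast hM
  rw [sub_nonpos, le_div_iff₀ hM', one_mul]
  exact_mod_cast (by omega : M ≤ exc R y x)

/-- The excess is `1`-Lipschitz under unit steps. [folklore] -/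
theorem exc_le_succ_of_step {R : ℕ} {y x x' : Site d} (h : ∀ j, |x' j - x j| ≤ 1) : exc R y x' ≤ exc R y x + 1 := by
  refine Finset.sup_le fun j _ => ?_
  have h1 : (x' j - y j).natAbs ≤ (x j - y j).natAbs + 1 := by
    have h2 : x' j - y j = (x j - y j) + (x' j - x j) := by ring
    have h3 : (x' j - x j).natAbs ≤ 1 := by
      rw [← Int.ofNat_le, Int.natCast_natAbs]; exact_mod_cast h j
    rw [h2]
    exact (Int.natAbs_add_le _ _).trans (by omega)
  calc (x' j - y j).natAbs - R ≤ ((x j - y j).natAbs - R) + 1 := by omega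
    _ ≤ exc R y x + 1 := by
        have := Finset.le_sup (f := fun i : Fin d => (x i - y i).natAbs - R) (Finset.mem_univ j)
        exact Nat.add_le_add_right this 1

/-- `|max(0,p) − max(0,q)| ≤ |p − q|`. [folklore] -/
theorem abs_max_zero_sub_le (p q : ℝ) : |max 0 p - max 0 q| ≤ |p - q| := by
  refine (abs_max_sub_max_le_max (0 : ℝ) p 0 q).trans (max_le ?_ le_rfl)
  rw [sub_self, abs_zero]; exact abs_nonneg _

/-- `χ` is `1/M`-Lipschitz under unit steps. [folklore] -/
theorem abs_chi_sub_chi_le_of_step {R M : ℕ} (hM : 1 ≤ M) {y x x' : Site d} (h : ∀ j, |x' j - x j| ≤ 1) :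
    |chi R M y x' - chi R M y x| ≤ 1 / M := by
  have hM' : (0 : ℝ) < M := by exact_mod_cast hM
  have h1 : (exc R y x' : ℝ) ≤ exc R y x + 1 := by exact_mod_cast exc_le_succ_of_step h
  have h2 : (exc R y x : ℝ) ≤ exc R y x' + 1 := by
    have h' : ∀ j, |x j - x' j| ≤ 1 := fun j => by rw [abs_sub_comm]; exact h j
    exact_mod_cast exc_le_succ_of_step h'
  unfold chi
  refine (abs_max_zero_sub_le _ _).trans ?_
  rw [show (1 : ℝ) - (exc R y x' : ℝ) / M - (1 - (exc R y x : ℝ) / M) = ((exc R y x : ℝ) - exc R y x') / M by ring,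
    abs_div, abs_of_pos hM']
  refine div_le_div_of_nonneg_right (abs_le.mpr ⟨?_, ?_⟩) hM'.le <;> linarith

/-- `|χ(x) − χ(x − e_i)| ≤ 1/M`. [folklore] -/
theorem abs_chi_sub_le {R M : ℕ} (hM : 1 ≤ M) (y x : Site d) (i : Fin d) :
    |chi R M y x - chi R M y (x - e i)| ≤ 1 / M :=
  abs_chi_sub_chi_le_of_step hM fun j => by
    have := abs_e_apply_le (d := d) i j
    simp only [Pi.sub_apply, sub_sub_cancel]
    exact this

/-- `|χ(x + e_i) − χ(x)| ≤ 1/M`. [folklore] -/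
theorem abs_chi_add_sub_le {R M : ℕ} (hM : 1 ≤ M) (y x : Site d) (i : Fin d) :
    |chi R M y (x + e i) - chi R M y x| ≤ 1 / M :=
  abs_chi_sub_chi_le_of_step hM fun j => by
    have := abs_e_apply_le (d := d) i j
    simp only [Pi.add_apply, add_sub_cancel_left]
    exact this


/-! ## §4 Summation by parts against a supported weight -/

section Inner

variable [InnerProductSpace ℝ E]

/-- SUMMATION BY PARTS on a box against a weight `ρ` supported one layer inside:
`Σ ρ(x)⟪D_i u(x), w(x)⟫ = Σ ⟪u(x), ρ(x − e_i) w(x − e_i) − ρ(x) w(x)⟫` (no boundary term). [folklore] -/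
theorem sbp {R K : ℕ} (hKR : K + 1 ≤ R) (y : Site d) (i : Fin d) (ρ : Site d → ℝ)
    (hρ : ∀ x, x ∉ box K y → ρ x = 0) (u w : Site d → E) :
    ∑ x ∈ box R y, ρ x * inner ℝ (fd i u x) (w x)
      = ∑ x ∈ box R y, inner ℝ (u x) (ρ (x - e i) • w (x - e i) - ρ x • w x) := by
  have hshift := sum_box_shift hKR y i (fun z => ρ z * inner ℝ (u (z + e i)) (w z))
    (fun x hx => by rw [hρ x hx, zero_mul])
  simp only [sub_add_cancel] at hshift
  simp only [fd, inner_sub_left, mul_sub, Finset.sum_sub_distrib, inner_sub_right, real_inner_smul_right]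
  rw [← hshift]

/-- The weight difference decomposition used twice:
`ρ(x−e_i)•w(x−e_i) − ρ(x)•w(x) = −(ρ(x)•(w(x) − w(x−e_i))) − (ρ(x) − ρ(x−e_i))•w(x−e_i)`. [folklore] -/
theorem weight_decomp (a b : ℝ) (p q : E) : b • q - a • p = -(a • (p - q)) - (a - b) • q := by
  rw [smul_sub, sub_smul]; abel

/-- FIRST SUMMATION BY PARTS: `Σ χ²‖D_i g‖² = −Σ χ²⟪g, sd_i g⟫ − Σ (χ²(x) − χ²(x−e_i))⟪g(x), D_i g(x−e_i)⟫`. [folklore] -/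
theorem sum_sq_fd_eq {R K : ℕ} (hKR : K + 1 ≤ R) (y : Site d) (i : Fin d) (χ : Site d → ℝ)
    (hχ : ∀ x, x ∉ box K y → χ x = 0) (g : Site d → E) :
    ∑ x ∈ box R y, χ x ^ 2 * ‖fd i g x‖ ^ 2
      = -∑ x ∈ box R y, χ x ^ 2 * inner ℝ (g x) (sd i g x)
        - ∑ x ∈ box R y, (χ x ^ 2 - χ (x - e i) ^ 2) * inner ℝ (g x) (fd i g (x - e i)) := by
  have h := sbp hKR y i (fun x => χ x ^ 2) (fun x hx => by rw [hχ x hx]; ring) g (fd i g)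
  simp only [real_inner_self_eq_norm_sq] at h
  rw [h, ← Finset.sum_neg_distrib, ← Finset.sum_sub_distrib]
  refine Finset.sum_congr rfl fun x _ => ?_
  rw [weight_decomp, ← sd_eq, inner_sub_right, inner_neg_right, real_inner_smul_right, real_inner_smul_right]

/-- SECOND SUMMATION BY PARTS: `−Σ χ²⟪D_j f, D_j(Δf)⟫ = Σ χ²⟪Δf, sd_j f⟫ + Σ (χ²(x) − χ²(x−e_j))⟪Δf(x), D_j f(x−e_j)⟫`.
[folklore] -/
theorem neg_sum_fd_lap_eq {R K : ℕ} (hKR : K + 1 ≤ R) (y : Site d) (j : Fin d) (χ : Site d → ℝ)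
    (hχ : ∀ x, x ∉ box K y → χ x = 0) (f : Site d → E) :
    -∑ x ∈ box R y, χ x ^ 2 * inner ℝ (fd j f x) (fd j (lap f) x)
      = ∑ x ∈ box R y, χ x ^ 2 * inner ℝ (lap f x) (sd j f x)
        + ∑ x ∈ box R y, (χ x ^ 2 - χ (x - e j) ^ 2) * inner ℝ (lap f x) (fd j f (x - e j)) := by
  have h := sbp hKR y j (fun x => χ x ^ 2) (fun x hx => by rw [hχ x hx]; ring) (lap f) (fd j f)
  have h' : ∑ x ∈ box R y, χ x ^ 2 * inner ℝ (fd j f x) (fd j (lap f) x)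
      = ∑ x ∈ box R y, inner ℝ (lap f x) ((χ (x - e j)) ^ 2 • fd j f (x - e j) - χ x ^ 2 • fd j f x) := by
    rw [← h]
    exact Finset.sum_congr rfl fun x _ => by rw [real_inner_comm]
  rw [h', ← Finset.sum_neg_distrib, ← Finset.sum_add_distrib]
  refine Finset.sum_congr rfl fun x _ => ?_
  rw [weight_decomp, ← sd_eq, inner_sub_right, inner_neg_right, real_inner_smul_right, real_inner_smul_right]
  ring

end Inner

end

end Summit.QuantumFields.BalabanUV.T4Continuum.AveragingDeficitLatticeH2Prep
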